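import Literature.Analysis.FluidPDE.SelfSimilar
import Literature.Analysis.FluidPDE.SuitableWeak
import Summits.NavierStokesRegularity.NavierStokesRegularity.Theorems.QuantisedSymmetryLiouvilleKillsProfile
import HarnessLib

/-!
# Route `QuantisedSymmetry`, crux `PolyhedralTruncationBridge` (stmt-NavierStokesRegularity-11331): the DSS profile is singular at the origin

Support lemma `stub_dssSingularOrigin` of the birth skeleton (line `registered`) of the crux
`Theses.QuantisedSymmetry.PolyhedralTruncationBridge`: a `c`-discretely-self-similar field
`u : ℝ → ℝ³ → ℝ³` with `1 < c` (`nsRescale c u = u`, i.e. `c u(c²t, cx) = u(t, x)`) which is not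
a.e. zero on every negative time slice is UNBOUNDED on every backward parabolic cylinder
`Q_r(0, 0) = (−r², 0) × B_r(0)`, `0 < r`: the space–time origin is a genuine (finite) singular
point of the profile.

Proof (parabolic scaling only; Chae–Wolf 2017, §2 Step 5; Bradshaw–Tsai 2017, §1). Suppose
`‖u‖ ≤ M` on `Q_r(0, 0)`. From `nsRescale c u = u` we get `nsRescale c⁻¹ u = u`
(`nsRescale_inv_nsRescale`), hence `nsRescale (c⁻¹)^k u = u` for every `k : ℕ`
(`quantisedSymmetry_isDiscretelySelfSimilar_pow`), i.e.
`u t x = (c⁻¹)^k • u ((c⁻¹)^{2k} t) ((c⁻¹)^k x)`. For `t < 0` and any `x` the rescaled point lies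
in `Q_r(0, 0)` for all large `k` (`(c⁻¹)^k → 0`), so `‖u t x‖ ≤ (c⁻¹)^k M → 0`; thus `u t = 0`
for every `t < 0`, contradicting the nontriviality hypothesis. Neither the Navier–Stokes system
nor a Type-I bound is used.
-/

-- the summit namespace `…NavierStokesRegularity.NavierStokesRegularity…` is the tree convention (D-0017)
set_option linter.dupNamespace false

namespace Summit.NavierStokesRegularity.NavierStokesRegularity.Theorems

open MeasureTheory Filter Topology
open Literature.Analysis.FluidPDE

local notation "E3" => EuclideanSpace ℝ (Fin 3)

/-- **The DSS profile is singular at the space–time origin** (stub `stub_dssSingularOrigin` of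
the birth skeleton of `Theses.QuantisedSymmetry.PolyhedralTruncationBridge`). A
`c`-discretely-self-similar field `u : ℝ → ℝ³ → ℝ³` with `1 < c` which is not a.e. zero on every
negative time slice is unbounded on every backward parabolic cylinder
`Q_r(0, 0) = (−r², 0) × B_r(0)`, `0 < r`: for every level `M` some point `z ∈ Q_r(0, 0)` has
`M < ‖u z.1 z.2‖`. (If `‖u‖ ≤ M` on `Q_r(0, 0)`, iterating `u(t, x) = c⁻ᵏ u(c⁻²ᵏ t, c⁻ᵏ x)`
gives `‖u(t, x)‖ ≤ c⁻ᵏ M → 0`, so `u ≡ 0` on `t < 0`; Chae–Wolf 2017, §2 Step 5.) [folklore] -/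
theorem stub_dssSingularOrigin :
    ∀ c : ℝ, 1 < c → ∀ u : ℝ → E3 → E3,
      IsDiscretelySelfSimilar c u → ¬ (∀ t < 0, u t =ᵐ[volume] 0) →
      ∀ r : ℝ, 0 < r → ∀ M : ℝ,
        ∃ z ∈ parabolicCylinder r ((0 : ℝ), (0 : E3)), M < ‖u z.1 z.2‖ := by
  intro c hc u hdss hnt r hr M
  by_contra hex
  -- the bound `‖u‖ ≤ M` on `Q_r(0, 0)`, in curried form
  have hbd : ∀ (s : ℝ) (y : E3),
      ((s, y) : ℝ × E3) ∈ parabolicCylinder r ((0 : ℝ), (0 : E3)) → ‖u s y‖ ≤ M :=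
    fun s y hsy => not_lt.1 fun hlt => hex ⟨(s, y), hsy, hlt⟩
  apply hnt
  have hc0 : 0 < c := one_pos.trans hc
  -- `u` is also `c⁻¹`-DSS, `0 < c⁻¹ < 1`
  have hdss' : IsDiscretelySelfSimilar c⁻¹ u := by
    have h := nsRescale_inv_nsRescale hc0.ne' u
    unfold IsDiscretelySelfSimilar at hdss ⊢
    rwa [hdss] at h
  obtain ⟨q, hq0, hq1, hq⟩ : ∃ q : ℝ, 0 < q ∧ q < 1 ∧ IsDiscretelySelfSimilar q u :=
    ⟨c⁻¹, inv_pos.2 hc0, inv_lt_one_of_one_lt₀ hc, hdss'⟩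
  have hqk : Tendsto (fun k : ℕ => q ^ k) atTop (𝓝 0) :=
    tendsto_pow_atTop_nhds_zero_of_lt_one hq0.le hq1
  -- every negative slice vanishes identically
  have hzero : ∀ t < 0, ∀ x : E3, u t x = 0 := by
    intro t ht x
    -- for `k` large the rescaled point `((q^k)² t, q^k x)` lies in `Q_r(0, 0)`
    have h1 : ∀ᶠ k : ℕ in atTop, -r ^ 2 < (q ^ k) ^ 2 * t := by
      have h := (hqk.pow 2).mul_const t
      rw [zero_pow two_ne_zero, zero_mul] at h
      exact h.eventually_const_lt (neg_lt_zero.2 (pow_pos hr 2))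
    have h2 : ∀ᶠ k : ℕ in atTop, q ^ k * ‖x‖ < r := by
      have h := hqk.mul_const ‖x‖
      rw [zero_mul] at h
      exact h.eventually_lt_const hr
    have h3 : ∀ᶠ k : ℕ in atTop, ‖u t x‖ ≤ q ^ k * M := by
      filter_upwards [h1, h2] with k hk1 hk2
      have hqk0 : 0 < q ^ k := pow_pos hq0 k
      have hmem : (((q ^ k) ^ 2 * t, q ^ k • x) : ℝ × E3) ∈
          parabolicCylinder r ((0 : ℝ), (0 : E3)) := by
        simp only [mem_parabolicCylinder, zero_sub, dist_zero_right]
        refine ⟨⟨hk1, mul_neg_of_pos_of_neg (pow_pos hqk0 2) ht⟩, ?_⟩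
        rw [norm_smul, Real.norm_of_nonneg hqk0.le]
        exact hk2
      have hrepr : u t x = q ^ k • u ((q ^ k) ^ 2 * t) (q ^ k • x) :=
        (congrFun (congrFun (quantisedSymmetry_isDiscretelySelfSimilar_pow hq k) t) x).symm
      rw [hrepr, norm_smul, Real.norm_of_nonneg hqk0.le]
      exact mul_le_mul_of_nonneg_left (hbd _ _ hmem) hqk0.le
    -- `q^k M → 0`, so `‖u t x‖ ≤ 0`
    have hlim : Tendsto (fun k : ℕ => q ^ k * M) atTop (𝓝 0) := by
      have h := hqk.mul_const M
      rwa [zero_mul] at h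
    exact norm_le_zero_iff.1 (ge_of_tendsto hlim h3)
  intro t ht
  exact Eventually.of_forall (hzero t ht)

end Summit.NavierStokesRegularity.NavierStokesRegularity.Theorems
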